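import Summits.BirchSwinnertonDyer.BirchSwinnertonDyer.Theorems.ClassRecordThreeEulerHalvesAtThreeSection6Bridge
import Summits.BirchSwinnertonDyer.Rank1Residual.Partition.Rows
import Literature.NumberTheory.EllipticCurves.LangHeightNonarchEstimate
import HarnessLib

/-!
# Route `ErratumRoadFive` (rung K2), crux child `NonSurjCornerKolyJ` (item stmt-BirchSwinnertonDyer-19947), registered stub
# `stub_kolyJ_max` (skeleton v2) — and the 19111 kit's `stub_upper3_jetchevMax` —: the READING-GRADE DISPLAY
# «stub ⟸ {Kolyvagin's redefinition of m_∞ at the frame (hK), the per-level inequality at the frame (hlev)}», everything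
# else kernel — the corner twin of tam3-p1's `jetchevMaxHLAtThree_of_perLevel` (p486881)
# (cell `bsd-stepL`, seat `bsd-stepL-corner-p1` g7; `--supports stmt-BirchSwinnertonDyer-19947`)

WHAT. `Koly.pDiv_of_perLevel` (tam3 `…Section6Bridge`, p-generic) turns, at ONE frame `(Dt, β, ι)` and prime `p`, the pair
{hK: «`m_∞ : ℕ` is `≤ m(n)` for every admissible `(n, d)` and attained at admissible conductors of arbitrarily large index
`M(n)`» (McCallum 1991 Lemma 5.1 + Prop. 5.2 for `y_K` of infinite order — on the corner this needs Prop. 5.2 under (irr):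
Cha 2005 Rmk. 25 ∕ MN19 §0.11 in print; the tree's typed `McCallum1991.prop52_…` carries the p-adic TOWER, VOID here),
hlev: «for every carrier place `v`, level `k` and admissible `(n, d)` with `m(n) < k`, `ord_p c_v ≤ k`, `k + m(n) ≤ M(n)`:
`ord_p c_v ≤ m(n)`» (= the conclusion of tam3's instantiated walk `Koly.tamagawaExponent_le_m_of_admissibleFamilies`, p497855,
given the per-frame supply; its Galois-image inputs on the corner are this seat's p501189 ∕ p501512, the `v ∣ p` clause of
h49 ∕ hdual_q is CORNER-G7.md §1)} into the MAX-form Jetchev divisibility at that frame. This file states that display with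
the corner frames' binders VERBATIM, so that the two registered max-form stubs read, in the tree, ⟸ {hK, hlev}:
* §1 **`nonSurjCornerKolyJ_max_of_perLevel`** — conclusion = `stub_kolyJ_max` of `Cruxes/NonSurjCornerKolyJ/Lines/birth.lean`
  (v2, registered 2026-08-27T04:44Z) VERBATIM; `p ∈ {5,7}` generic.
* §2 **`cornerUpper3_jetchevMax_of_perLevel`** — conclusion = `stub_upper3_jetchevMax` of the proposed 19111 kit
  `HOME/corner/g7/bc3/CornerAtThreeUpper_birth.lean` VERBATIM (`p = 3`).
HONEST FRAMING: two theorems (no definition, no named fact, no `sorry`), pure bookkeeping over `pDiv_of_perLevel`; hK and hlev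
are HYPOTHESES; nothing is discharged; no stub closes; nothing asserted about any curve; BSD not advanced (T7).

References: [Jetchev2008] Thm. 1.4 (p. 812), Proof of Thm. 1.4 (p. 825); [McCallumLMS1991] §5 Lemma 5.1, Prop. 5.2
(pp. 303–306); [Cha2005] Rmk. 25; [MatarNekovar2019] §0.11; tree: tam3-p1 p486881 ∕ p486458 (`pDiv_of_perLevel`).
-/

set_option autoImplicit false
set_option linter.dupNamespace false

noncomputable section

open scoped Classical NumberField

namespace Summit.BirchSwinnertonDyer.Rank1Residual.X11b.Three.Koly

open WeierstrassCurve Literature.NumberTheory.EllipticCurves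
  Literature.NumberTheory.EllipticCurves.ModularForms
  Literature.NumberTheory.EllipticCurves.Rank1Residual
  Summit.BirchSwinnertonDyer.Rank1Residual Summit.BirchSwinnertonDyer.Rank1Residual.X11b
  IsDedekindDomain NumberField

/-! ### §1 `stub_kolyJ_max` (19947 v2) ⟸ {hK, hlev} -/

/-- **`stub_kolyJ_max` ⟸ {Kolyvagin's redefinition of `m_∞` at the corner frame, the per-level inequality at the corner
frame}.** Corner twin of tam3-p1's `jetchevMaxHLAtThree_of_perLevel`: the frame binders are those of 19947's registered
`stub_kolyJ_max` verbatim (`p ∣ ∏c`, (T4′) corner pair, `p ∈ {5,7}`, Heegner `K` with `|d_K| > 4`, orientation `β`,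
Manin-good `Dt` of level `N_E`); `m(n) := ord_p(P_n)` if `< M(n)`, else `∞`. Proof: `pDiv_of_perLevel` at `t = ord_p c_v`.
CONDITIONAL on hK, hlev; nothing booked. [cite: Jetchev2008, Thm. 1.4 (p. 812), Proof of Thm. 1.4 (p. 825)]
[cite: McCallumLMS1991, §5 Lemma 5.1, Prop. 5.2 (pp. 303–304)] -/
theorem nonSurjCornerKolyJ_max_of_perLevel
    (hK : ∀ (W : WeierstrassCurve ℚ) [W.IsElliptic] [W.IsGloballyMinimal] [NeZero (W.conductorNorm ℤ)]
      (p : ℕ) [Fact p.Prime] (K : Type) [Field K] [NumberField K]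
      (Dt : ModularParametrizationData W (W.conductorNorm ℤ)) (β : ℤ) (ι : K →+* ℂ),
      p ∣ W.tamagawaProduct →
      ClassX11b W p → ¬ Surj W p → (p = 5 ∨ p = 7) → p ∣ padicValInt p W.minimalDiscriminantInt →
      ¬ Ram W p → IsImaginaryQuadratic K → 4 < (NumberField.discr K).natAbs →
      SatisfiesHeegnerHypothesis (W.conductorNorm ℤ) K → SatisfiesHeegnerHypothesis p K →
      (4 * (W.conductorNorm ℤ : ℤ)) ∣ β ^ 2 - NumberField.discr K → ¬ (p : ℤ) ∣ Dt.c →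
      ∃ mInf : ℕ,
        (∀ (n : ℕ) (d : KolyvaginHeegnerData Dt β ι n), Squarefree n →
          (∀ ℓ ∈ n.primeFactors, Zhang2014.IsKolyvaginPrime (W.conductorNorm ℤ) W K p ℓ) →
          (mInf : ℕ∞) ≤ (if divOrd d p < Zhang2014.levelIndex W p n then divOrd d p else ⊤)) ∧
        (∀ m' : ℕ, ∃ (n : ℕ) (d : KolyvaginHeegnerData Dt β ι n), Squarefree n ∧
          (∀ ℓ ∈ n.primeFactors, Zhang2014.IsKolyvaginPrime (W.conductorNorm ℤ) W K p ℓ) ∧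
          (m' : ℕ∞) ≤ Zhang2014.levelIndex W p n ∧
          (if divOrd d p < Zhang2014.levelIndex W p n then divOrd d p else (⊤ : ℕ∞)) = mInf))
    (hlev : ∀ (W : WeierstrassCurve ℚ) [W.IsElliptic] [W.IsGloballyMinimal] [NeZero (W.conductorNorm ℤ)]
      (p : ℕ) [Fact p.Prime] (K : Type) [Field K] [NumberField K]
      (Dt : ModularParametrizationData W (W.conductorNorm ℤ)) (β : ℤ) (ι : K →+* ℂ),
      p ∣ W.tamagawaProduct →
      ClassX11b W p → ¬ Surj W p → (p = 5 ∨ p = 7) → p ∣ padicValInt p W.minimalDiscriminantInt →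
      ¬ Ram W p → IsImaginaryQuadratic K → 4 < (NumberField.discr K).natAbs →
      SatisfiesHeegnerHypothesis (W.conductorNorm ℤ) K → SatisfiesHeegnerHypothesis p K →
      (4 * (W.conductorNorm ℤ : ℤ)) ∣ β ^ 2 - NumberField.discr K → ¬ (p : ℤ) ∣ Dt.c →
      ∀ (v : HeightOneSpectrum (𝓞 ℚ)) (k n : ℕ) (d : KolyvaginHeegnerData Dt β ι n), Squarefree n →
        (∀ ℓ ∈ n.primeFactors, Zhang2014.IsKolyvaginPrime (W.conductorNorm ℤ) W K p ℓ) →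
        (if divOrd d p < Zhang2014.levelIndex W p n then divOrd d p else (⊤ : ℕ∞)) < (k : ℕ∞) →
        padicValNat p (W.tamagawaNumberAt v) ≤ k →
        (k : ℕ∞) + (if divOrd d p < Zhang2014.levelIndex W p n then divOrd d p else ⊤) ≤
          Zhang2014.levelIndex W p n →
        (padicValNat p (W.tamagawaNumberAt v) : ℕ∞) ≤
          (if divOrd d p < Zhang2014.levelIndex W p n then divOrd d p else ⊤)) :
    ∀ (W : WeierstrassCurve ℚ) [W.IsElliptic] [W.IsGloballyMinimal] [NeZero (W.conductorNorm ℤ)]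
      (p : ℕ) [Fact p.Prime] (K : Type) [Field K] [NumberField K]
      (Dt : ModularParametrizationData W (W.conductorNorm ℤ)) (β : ℤ) (ι : K →+* ℂ),
      p ∣ W.tamagawaProduct →
      ClassX11b W p → ¬ Surj W p → (p = 5 ∨ p = 7) → p ∣ padicValInt p W.minimalDiscriminantInt →
      ¬ Ram W p → IsImaginaryQuadratic K → 4 < (NumberField.discr K).natAbs →
      SatisfiesHeegnerHypothesis (W.conductorNorm ℤ) K → SatisfiesHeegnerHypothesis p K →
      (4 * (W.conductorNorm ℤ : ℤ)) ∣ β ^ 2 - NumberField.discr K → ¬ (p : ℤ) ∣ Dt.c →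
      ∀ (v : HeightOneSpectrum (𝓞 ℚ)) (s : ℕ), s ≤ padicValNat p (W.tamagawaNumberAt v) →
        ∀ (n : ℕ) (d : KolyvaginHeegnerData Dt β ι n), Squarefree n →
          (∀ ℓ ∈ n.primeFactors, Zhang2014.IsKolyvaginPrime (W.conductorNorm ℤ) W K p ℓ ∧
            s ≤ Zhang2014.kolyvaginIndex W p ℓ) → PDiv d p s := by
  intro W _ _ _ p _ K _ _ Dt β ι htam hX hns h57 hv hnr hK' hd hHN hHp hβ hc v s hs n d hn hℓ
  obtain ⟨mInf, hmInf, hKol⟩ := hK W p K Dt β ι htam hX hns h57 hv hnr hK' hd hHN hHp hβ hc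
  exact pDiv_of_perLevel (Dt := Dt) (β := β) (ι := ι) p (padicValNat p (W.tamagawaNumberAt v)) mInf
    (fun n d => if divOrd d p < Zhang2014.levelIndex W p n then divOrd d p else ⊤)
    (fun n d _ _ h => by simp [h]) hmInf hKol
    (fun k n d hn' hℓ' h1 h2 h3 =>
      hlev W p K Dt β ι htam hX hns h57 hv hnr hK' hd hHN hHp hβ hc v k n d hn' hℓ' h1 h2 h3)
    s hs n d hn hℓ

/-! ### §2 `stub_upper3_jetchevMax` (19111 Upper kit) ⟸ {hK, hlev} -/

/-- **`stub_upper3_jetchevMax` ⟸ {Kolyvagin's redefinition of `m_∞`, the per-level inequality} at the (T4″)@3 corner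
frames** (`ClassX11b W 3`, `¬ Surj W 3`, odd Heegner `d_K`, orientation `β`, `3 ∤ Dt.c`). Same proof at `p = 3`.
CONDITIONAL on hK, hlev; nothing booked. [cite: Jetchev2008, Thm. 1.4 (p. 812)] [cite: McCallumLMS1991, §5 Prop. 5.2 (p. 304)] -/
theorem cornerUpper3_jetchevMax_of_perLevel
    (hK : ∀ (W : WeierstrassCurve ℚ) [W.IsElliptic] [W.IsGloballyMinimal] [NeZero (W.conductorNorm ℤ)]
      (K : Type) [Field K] [NumberField K]
      (Dt : ModularParametrizationData W (W.conductorNorm ℤ)) (β : ℤ) (ι : K →+* ℂ),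
      ClassX11b W 3 → ¬ Surj W 3 →
      IsImaginaryQuadratic K → SatisfiesHeegnerHypothesis (W.conductorNorm ℤ) K →
      Odd (NumberField.discr K) →
      (4 * (W.conductorNorm ℤ : ℤ)) ∣ β ^ 2 - NumberField.discr K → ¬ (3 : ℤ) ∣ Dt.c →
      ∃ mInf : ℕ,
        (∀ (n : ℕ) (d : KolyvaginHeegnerData Dt β ι n), Squarefree n →
          (∀ ℓ ∈ n.primeFactors, Zhang2014.IsKolyvaginPrime (W.conductorNorm ℤ) W K 3 ℓ) →
          (mInf : ℕ∞) ≤ (if divOrd d 3 < Zhang2014.levelIndex W 3 n then divOrd d 3 else ⊤)) ∧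
        (∀ m' : ℕ, ∃ (n : ℕ) (d : KolyvaginHeegnerData Dt β ι n), Squarefree n ∧
          (∀ ℓ ∈ n.primeFactors, Zhang2014.IsKolyvaginPrime (W.conductorNorm ℤ) W K 3 ℓ) ∧
          (m' : ℕ∞) ≤ Zhang2014.levelIndex W 3 n ∧
          (if divOrd d 3 < Zhang2014.levelIndex W 3 n then divOrd d 3 else (⊤ : ℕ∞)) = mInf))
    (hlev : ∀ (W : WeierstrassCurve ℚ) [W.IsElliptic] [W.IsGloballyMinimal] [NeZero (W.conductorNorm ℤ)]
      (K : Type) [Field K] [NumberField K]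
      (Dt : ModularParametrizationData W (W.conductorNorm ℤ)) (β : ℤ) (ι : K →+* ℂ),
      ClassX11b W 3 → ¬ Surj W 3 →
      IsImaginaryQuadratic K → SatisfiesHeegnerHypothesis (W.conductorNorm ℤ) K →
      Odd (NumberField.discr K) →
      (4 * (W.conductorNorm ℤ : ℤ)) ∣ β ^ 2 - NumberField.discr K → ¬ (3 : ℤ) ∣ Dt.c →
      ∀ (v : HeightOneSpectrum (𝓞 ℚ)) (k n : ℕ) (d : KolyvaginHeegnerData Dt β ι n), Squarefree n →
        (∀ ℓ ∈ n.primeFactors, Zhang2014.IsKolyvaginPrime (W.conductorNorm ℤ) W K 3 ℓ) →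
        (if divOrd d 3 < Zhang2014.levelIndex W 3 n then divOrd d 3 else (⊤ : ℕ∞)) < (k : ℕ∞) →
        padicValNat 3 (W.tamagawaNumberAt v) ≤ k →
        (k : ℕ∞) + (if divOrd d 3 < Zhang2014.levelIndex W 3 n then divOrd d 3 else ⊤) ≤
          Zhang2014.levelIndex W 3 n →
        (padicValNat 3 (W.tamagawaNumberAt v) : ℕ∞) ≤
          (if divOrd d 3 < Zhang2014.levelIndex W 3 n then divOrd d 3 else ⊤)) :
    ∀ (W : WeierstrassCurve ℚ) [W.IsElliptic] [W.IsGloballyMinimal] [NeZero (W.conductorNorm ℤ)]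
      (K : Type) [Field K] [NumberField K]
      (Dt : ModularParametrizationData W (W.conductorNorm ℤ)) (β : ℤ) (ι : K →+* ℂ),
      ClassX11b W 3 → ¬ Surj W 3 →
      IsImaginaryQuadratic K → SatisfiesHeegnerHypothesis (W.conductorNorm ℤ) K →
      Odd (NumberField.discr K) →
      (4 * (W.conductorNorm ℤ : ℤ)) ∣ β ^ 2 - NumberField.discr K → ¬ (3 : ℤ) ∣ Dt.c →
      ∀ (v : HeightOneSpectrum (𝓞 ℚ)) (s : ℕ), s ≤ padicValNat 3 (W.tamagawaNumberAt v) →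
        ∀ (n : ℕ) (d : KolyvaginHeegnerData Dt β ι n), Squarefree n →
          (∀ ℓ ∈ n.primeFactors, Zhang2014.IsKolyvaginPrime (W.conductorNorm ℤ) W K 3 ℓ ∧
            s ≤ Zhang2014.kolyvaginIndex W 3 ℓ) → PDiv d 3 s := by
  intro W _ _ _ K _ _ Dt β ι hX hns hK' hHN hodd hβ hc v s hs n d hn hℓ
  obtain ⟨mInf, hmInf, hKol⟩ := hK W K Dt β ι hX hns hK' hHN hodd hβ hc
  exact pDiv_of_perLevel (Dt := Dt) (β := β) (ι := ι) 3 (padicValNat 3 (W.tamagawaNumberAt v)) mInf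
    (fun n d => if divOrd d 3 < Zhang2014.levelIndex W 3 n then divOrd d 3 else ⊤)
    (fun n d _ _ h => by simp [h]) hmInf hKol
    (fun k n d hn' hℓ' h1 h2 h3 => hlev W K Dt β ι hX hns hK' hHN hodd hβ hc v k n d hn' hℓ' h1 h2 h3)
    s hs n d hn hℓ

end Summit.BirchSwinnertonDyer.Rank1Residual.X11b.Three.Koly

end
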